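import Mathlib.CategoryTheory.SingleObj
import Mathlib.CategoryTheory.Endomorphism
import Mathlib.Algebra.DirectSum.Basic
import Mathlib.Data.ZMod.Basic
import Mathlib.Data.PNat.Basic
import Mathlib.Data.Nat.Prime.Basic
import Literature.AlgebraicGeometry.Frobenioids.Categories
import Literature.AlgebraicGeometry.Frobenioids.CategoriesFactorization
import Literature.AlgebraicGeometry.Frobenioids.ElementaryFrobenioid
import HarnessLib

/-!
# Frobenioids I, §3: Example 3.6 (Frobenioids of standard and group-like type)

Mochizuki, *The geometry of Frobenioids I: the general theory*, Kyushu J. Math. **62** (2008)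
293–400, kurims text pp. 70–71 [cite: MochizukiFrdI2008, Ex. 3.6 p.70, Ex. 3.7 pp.70-71]: two of the
one-object examples "in which some of the conditions [of Theorem 3.4] hold, but others do not"
(p. 69).  Companion of `BaseCategoryTheoreticityExamples.lean` (Ex. 3.5, 3.10, seat abc-iut-L1-t3).

**General lemma (the "identification" sentence of Ex. 3.5/3.6/3.10).** For a one-object category
`D` with endomorphism monoid `X` and the monoid `Φ` on `D` assigning a commutative monoid `V` to the
unique object and the identity to every arrow, the endomorphism monoid of the unique object of the
elementary Frobenioid `F_Φ` (found's `ElemFrobenioid`, Def. 1.1 (iii)) is `X × F_V`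
(`endEquivProd`, PROVED) — "`C` may be identified with the elementary Frobenioid determined by the
monoid on `D` that assigns to the unique object of `D` the monoid `G` and to every morphism of `D`
the identity automorphism of `G`" (p. 70).  `F_V` is found's `ElemFrobenioidMonoid` (no new copy).

**Example 3.6** (`G := ℤ ⊕ ⨁_{p} ℤ/pℤ`, `D` = one object with `End = F_G`, `C` = one object with
`End = F_G × F_G`, `C → D` the first projection): DEFINED; PROVED: "every morphism of `D` is either
an isomorphism or a non-monomorphism", "`D` is of FSM-, hence also of FSMFF-type", and "the
self-equivalence … switching the two factors clearly fails to preserve base-isomorphisms"; typed as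
named statements: "`D` is slim", "the irreducible morphisms of `D` are precisely the morphisms that
project to primes of `N_{≥1}`".
**Example 3.7** (dilating monoids, same `G`, `D`) is in the sequel file `DilatingMonoidExample.lean`.

Deliberately NOT here (need Def. 1.2/1.3 and §3 Def. 3.1, files of seats found/t3, not yet landed):
"`C` is a Frobenioid of Frobenius-normalized, isotropic and group-like type", "the unique object of
`C` is Frobenius-compact", "`C` is of standard type", "preserves pre-steps" — to be typed in the
§3 glue file over those predicates.  No statement of the paper is strengthened.
-/

namespace Literature.AlgebraicGeometry.Frobenioids

open CategoryTheory

/-! ### One-object bases with trivial action: `End_{F_Φ} = X × F_V` -/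

section OneObject

variable (X : Type) [Monoid X] (V : Type) [CommMonoid V]

/-- The monoid on the one-object category `SingleObj X` "that assigns to the unique object … the
monoid `V` and to every morphism … the identity automorphism of `V`" (FrdI Ex. 3.5/3.6/3.10,
pp. 69–72). [cite: MochizukiFrdI2008, Ex. 3.6 p.70] -/
def trivialMonoidOn : (SingleObj X)ᵒᵖ ⥤ CommMonCat.{0} :=
  (Functor.const _).obj (CommMonCat.of V)

/-- The unique object of `F_Φ` for `Φ = trivialMonoidOn X V`. [cite: MochizukiFrdI2008, Ex. 3.6 p.70] -/
abbrev trivObj : ElemFrobenioid (trivialMonoidOn X V) :=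
  ElemFrobenioid.of (trivialMonoidOn X V) (SingleObj.star X)

/-- Pull-backs of the trivial monoid are identities. [cite: MochizukiFrdI2008, Ex. 3.6 p.70] -/
@[simp] theorem pull_trivialMonoidOn {A B : SingleObj X} (f : B ⟶ A) (v : V) :
    pull (trivialMonoidOn X V) f v = v := rfl

/-- "`C` may be identified with the elementary Frobenioid determined by the monoid on `D` that
assigns … the monoid `V` and to every morphism … the identity": the endomorphism monoid of the unique
object of `F_Φ` (`Φ` trivial with value `V` on the one-object category of `X`) is `X × F_V` — the
first factor is `Base`, the second is `(Div, deg_Fr)` (FrdI Ex. 3.6 p. 70; also Ex. 3.5 p. 69,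
Ex. 3.10 p. 72). [cite: MochizukiFrdI2008, Ex. 3.6 p.70] -/
def endEquivProd : End (trivObj X V) ≃* X × ElemFrobenioidMonoid V where
  toFun φ := (ElemFrobenioid.Base φ, ⟨ElemFrobenioid.Div φ, ElemFrobenioid.degFr φ⟩)
  invFun x := ElemFrobenioid.homMk x.1 x.2.div x.2.degFr
  left_inv _ := rfl
  right_inv _ := rfl
  map_mul' φ ψ := by
    refine Prod.ext ?_ (ElemFrobenioidMonoid.ext ?_ ?_)
    · rfl
    · show pull (trivialMonoidOn X V) _ (ElemFrobenioid.Div φ) * _ = _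
      rfl
    · show ElemFrobenioid.degFr ψ * ElemFrobenioid.degFr φ = ElemFrobenioid.degFr φ * _
      exact mul_comm _ _

end OneObject

/-! ### Units and isomorphisms in `F_A` for an abelian group `A` -/

section Units

variable {A : Type} [AddCommGroup A]

/-- In `F_A` (`A` an abelian group) an element is a unit iff its Frobenius degree is `1`.
[cite: MochizukiFrdI2008, Ex. 3.6 p.70] -/
theorem isUnit_iff_degFr_eq_one (x : ElemFrobenioidMonoid (Multiplicative A)) :
    IsUnit x ↔ x.degFr = 1 := by
  constructor
  · rintro ⟨u, rfl⟩
    have h := congrArg ElemFrobenioidMonoid.degFr u.mul_inv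
    rw [ElemFrobenioidMonoid.mul_degFr, ElemFrobenioidMonoid.one_degFr] at h
    have h' : ((u : ElemFrobenioidMonoid (Multiplicative A)).degFr : ℕ) *
        ((↑u⁻¹ : ElemFrobenioidMonoid (Multiplicative A)).degFr : ℕ) = 1 := by
      exact_mod_cast h
    exact PNat.coe_eq_one_iff.mp (Nat.eq_one_of_mul_eq_one_right h')
  · intro h
    refine ⟨⟨x, ⟨x.div⁻¹, 1⟩, ?_, ?_⟩, rfl⟩
    · refine ElemFrobenioidMonoid.ext ?_ ?_
      · show x.div * x.div⁻¹ ^ (x.degFr : ℕ) = 1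
        rw [h, PNat.one_coe, pow_one, mul_inv_cancel]
      · show x.degFr * 1 = 1
        rw [h, mul_one]
    · refine ElemFrobenioidMonoid.ext ?_ ?_
      · show x.div⁻¹ * x.div ^ ((1 : ℕ+) : ℕ) = 1
        rw [PNat.one_coe, pow_one, inv_mul_cancel]
      · show 1 * x.degFr = 1
        rw [h, mul_one]

/-- In a one-object category `SingleObj M`, an arrow is an isomorphism iff it is a unit of `M`.
[cite: MochizukiFrdI2008, §0 p.14] -/
theorem SingleObj.isIso_iff_isUnit {M : Type} [Monoid M] {x y : SingleObj M} (f : x ⟶ y) :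
    IsIso f ↔ IsUnit (show M from f) := by
  constructor
  · intro hf
    refine ⟨⟨f, inv f, ?_, ?_⟩, rfl⟩
    · have := IsIso.inv_hom_id f
      rwa [SingleObj.comp_as_mul, SingleObj.id_as_one] at this
    · have := IsIso.hom_inv_id f
      rwa [SingleObj.comp_as_mul, SingleObj.id_as_one] at this
  · rintro ⟨u, hu⟩
    refine ⟨⟨(↑u⁻¹ : M), ?_, ?_⟩⟩
    · rw [SingleObj.comp_as_mul, SingleObj.id_as_one, ← hu, Units.inv_mul]
    · rw [SingleObj.comp_as_mul, SingleObj.id_as_one, ← hu, Units.mul_inv]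

/-- In a one-object category `SingleObj M`, an arrow `f` is a monomorphism iff `f` is left-regular in
`M` (`f * g = f * h ⇒ g = h`). [cite: MochizukiFrdI2008, §0 p.14] -/
theorem SingleObj.mono_iff_isLeftRegular {M : Type} [Monoid M] {x y : SingleObj M} (f : x ⟶ y) :
    Mono f ↔ IsLeftRegular (show M from f) := by
  constructor
  · intro hf g h hgh
    have : (show x ⟶ x from g) ≫ f = (show x ⟶ x from h) ≫ f := by
      rw [SingleObj.comp_as_mul, SingleObj.comp_as_mul]; exact hgh
    exact (cancel_mono f).mp this
  · intro hf
    exact ⟨fun g h hgh => hf (by rwa [SingleObj.comp_as_mul, SingleObj.comp_as_mul] at hgh)⟩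

end Units

/-! ### Example 3.6: Frobenioids of standard and group-like type -/

namespace Ex36

/-- `G := ℤ ⊕ (⨁_{p ∈ Primes} ℤ/pℤ)` "[regarded as an abelian group]" (FrdI Ex. 3.6 p. 70).
[cite: MochizukiFrdI2008, Ex. 3.6 p.70] -/
abbrev G : Type := ℤ × DirectSum Nat.Primes fun p => ZMod p

/-- `F_G`, the endomorphism monoid of the unique object of `D` (FrdI Ex. 3.6 p. 70; found's `F_M`).
[cite: MochizukiFrdI2008, Ex. 3.6 p.70] -/
abbrev FG : Type := ElemFrobenioidMonoid (Multiplicative G)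

/-- `D`: "a one-object category whose unique object has endomorphism monoid `F_G`" (p. 70).
[cite: MochizukiFrdI2008, Ex. 3.6 p.70] -/
abbrev D : Type := SingleObj FG

/-- `C`: "a one-object category whose unique object has endomorphism monoid `F_G × F_G`" (p. 70).
[cite: MochizukiFrdI2008, Ex. 3.6 p.70] -/
abbrev C : Type := SingleObj (FG × FG)

/-- "the projection `F_G × F_G → F_G` to the first factor determines a functor `C → D`" (p. 70).
[cite: MochizukiFrdI2008, Ex. 3.6 p.70] -/
def toD : C ⥤ D := SingleObj.mapHom _ _ (MonoidHom.fst FG FG)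

/-- The monoid on `D` of Ex. 3.6: `G` with the trivial action (p. 70). [cite: MochizukiFrdI2008, Ex. 3.6 p.70] -/
abbrev Φ : Dᵒᵖ ⥤ CommMonCat.{0} := trivialMonoidOn FG (Multiplicative G)

/-- "`C` may be identified with the elementary Frobenioid determined by [`Φ`]": `End_{F_Φ} ≃ F_G × F_G`
(p. 70; instance of `endEquivProd`). [cite: MochizukiFrdI2008, Ex. 3.6 p.70] -/
def identification : End (trivObj FG (Multiplicative G)) ≃* FG × FG :=
  endEquivProd FG (Multiplicative G)

/-- "`D` is slim" (p. 70: every automorphism arising from `Aut(D_A → D)` is infinitely divisible in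
`G`, hence trivial) — named statement. [cite: MochizukiFrdI2008, Ex. 3.6 p.70] -/
def DSlim : Prop := IsSlim D

/-- The torsion witness: for `n > 1` there is `e ∈ G`, `e ≠ 0`, with `n • e = 0` (a generator of
`ℤ/pℤ`, `p ∣ n`) — "the existence of the torsion subgroup `⨁ ℤ/pℤ ⊆ G`" (p. 70).
[cite: MochizukiFrdI2008, Ex. 3.6 p.70] -/
theorem exists_torsion {n : ℕ} (hn : n ≠ 1) : ∃ e : G, e ≠ 0 ∧ n • e = 0 := by
  obtain ⟨p, hp, hpn⟩ := Nat.exists_prime_and_dvd hn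
  haveI : Fact p.Prime := ⟨hp⟩
  refine ⟨(0, DirectSum.of (fun q : Nat.Primes => ZMod q) ⟨p, hp⟩ 1), ?_, ?_⟩
  · intro h
    have h1 := congrArg (fun x : G => x.2 ⟨p, hp⟩) h
    simp only [DirectSum.of_eq_same, Prod.snd_zero, DirectSum.zero_apply] at h1
    exact one_ne_zero h1
  · refine Prod.ext (by simp) ?_
    show n • DirectSum.of (fun q : Nat.Primes => ZMod q) ⟨p, hp⟩ 1 = 0
    rw [← map_nsmul, nsmul_eq_mul, mul_one, (ZMod.natCast_eq_zero_iff n p).mpr hpn, map_zero]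

/-- In `F_G`, `g · (e, 1) = g · 1` whenever `deg_Fr(g) • e = 0`. [cite: MochizukiFrdI2008, Ex. 3.6 p.70] -/
theorem mul_torsion_eq {g : FG} {e : G} (hne : (g.degFr : ℕ) • e = 0) :
    g * ⟨Multiplicative.ofAdd e, 1⟩ = g * 1 := by
  refine ElemFrobenioidMonoid.ext ?_ ?_
  · show g.div * Multiplicative.ofAdd e ^ (g.degFr : ℕ) = g.div * (1 : Multiplicative G) ^ (g.degFr : ℕ)
    rw [one_pow, ← ofAdd_nsmul, hne, ofAdd_zero]
  · rfl

/-- An element of `F_G` of Frobenius degree `≠ 1` is not left-cancellable (it kills a torsion element).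
[cite: MochizukiFrdI2008, Ex. 3.6 p.70] -/
theorem not_isLeftRegular {g : FG} (h : g.degFr ≠ 1) : ¬ IsLeftRegular g := by
  intro hreg
  obtain ⟨e, he, hne⟩ := exists_torsion (n := (g.degFr : ℕ)) fun h' => h (PNat.coe_eq_one_iff.mp h')
  have h1 := congrArg ElemFrobenioidMonoid.div (hreg (mul_torsion_eq hne))
  exact he (by simpa using h1)

/-- "every morphism of `D` is either an isomorphism or a non-monomorphism [cf. the existence of the
torsion subgroup `⨁ ℤ/pℤ ⊆ G`]" (p. 70; PROVED: `(a, n)` with `n > 1` kills `(e, 1)` for `n • e = 0`).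
[cite: MochizukiFrdI2008, Ex. 3.6 p.70] -/
theorem isIso_or_not_mono {x y : D} (f : x ⟶ y) : IsIso f ∨ ¬ Mono f := by
  by_cases h : (show FG from f).degFr = 1
  · exact Or.inl ((SingleObj.isIso_iff_isUnit f).mpr ((isUnit_iff_degFr_eq_one _).mpr h))
  · exact Or.inr fun hm => not_isLeftRegular h ((SingleObj.mono_iff_isLeftRegular f).mp hm)

/-- "it follows immediately that `D` is of FSM-type" (p. 70; PROVED: an FSM-morphism is a monomorphism,
hence an isomorphism by `isIso_or_not_mono`). [cite: MochizukiFrdI2008, Ex. 3.6 p.70] -/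
theorem isOfFSMType : IsOfFSMType D :=
  ⟨fun f hf => (isIso_or_not_mono f).resolve_right (not_not.mpr hf.2)⟩

/-- "… hence also of FSMFF-type" (p. 70; PROVED via [FrdI] §0 p. 18). [cite: MochizukiFrdI2008, Ex. 3.6 p.70] -/
theorem isOfFSMFFType : IsOfFSMFFType D := isOfFSMType.isOfFSMFFType

/-- "the irreducible morphisms of `D` are precisely the morphisms that project via the natural
surjection `F_G → N_{≥1}` to primes of `N_{≥1}`" (p. 70) — named statement.
[cite: MochizukiFrdI2008, Ex. 3.6 p.70] -/
def IrreducibleIffPrime : Prop :=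
  ∀ {x y : D} (f : x ⟶ y), IsIrreducibleHom f ↔ ((show FG from f).degFr : ℕ).Prime

/-- The self-equivalence of `C` "determined by the automorphism of monoids `F_G × F_G ⥲ F_G × F_G`
given by switching the two factors" (p. 70). [cite: MochizukiFrdI2008, Ex. 3.6 p.70] -/
def swap : C ⥤ C := SingleObj.mapHom _ _ (MulEquiv.prodComm : FG × FG ≃* FG × FG).toMonoidHom

/-- `swap ∘ swap = id`; in particular `swap` is a self-equivalence. [cite: MochizukiFrdI2008, Ex. 3.6 p.70] -/
theorem swap_swap : swap ⋙ swap = 𝟭 C := rfl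

/-- The arrow `((0, 1), (0, 2))` of `C`: a base-isomorphism (its image in `D` is the identity) whose
`swap`-image `((0, 2), (0, 1))` projects to an arrow of Frobenius degree `2`, not an isomorphism.
[cite: MochizukiFrdI2008, Ex. 3.6 p.70] -/
def witness : SingleObj.star (FG × FG) ⟶ SingleObj.star (FG × FG) :=
  show FG × FG from ((1 : FG), (⟨1, 2⟩ : FG))

/-- "[`swap`] clearly fails to preserve base-isomorphisms [cf. Theorem 3.4, (iii)]" (p. 70; PROVED;
a base-isomorphism is an arrow whose projection to `D` is an isomorphism, [FrdI] Def. 1.2 (i)).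
[cite: MochizukiFrdI2008, Ex. 3.6 p.70] -/
theorem swap_not_preserves_baseIso :
    ∃ (x y : C) (φ : x ⟶ y), IsIso (toD.map φ) ∧ ¬ IsIso (toD.map (swap.map φ)) := by
  refine ⟨_, _, witness, ?_, ?_⟩
  · have : toD.map witness = 𝟙 _ := rfl
    rw [this]; infer_instance
  · rw [SingleObj.isIso_iff_isUnit, isUnit_iff_degFr_eq_one]
    exact fun h => absurd (congrArg PNat.val h) (by decide)

end Ex36

/-! ### Addendum (referee PASS-C2, C2-Fa): "[manifestly non-dilating]" -/

/-- A monoid on a category all of whose pull-back maps are identities is non-dilating (Def. 1.1 (ii)):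
the identity of `M` induces the identity of `M^char`. [cite: MochizukiFrdI2008, Def. 1.1 (ii) p.19] -/
theorem isNonDilatingOn_trivialMonoidOn (X : Type) [Monoid X] (V : Type) [CommMonoid V] :
    IsNonDilatingOn (trivialMonoidOn X V) := by
  intro A f _
  refine MonoidHom.ext fun a => ?_
  obtain ⟨x, rfl⟩ := Associates.mk_surjective a
  rfl

/-- **Example 3.6**, the bracket "the [manifestly non-dilating] monoid on `D` that assigns to the unique
object of `D` the monoid `G` and to every morphism of `D` the identity automorphism of `G`"
(FrdI p. 70; PROVED — ref-c C2-Fa). [cite: MochizukiFrdI2008, Ex. 3.6 p.70] -/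
theorem Ex36.isNonDilatingOn_Φ : IsNonDilatingOn Ex36.Φ :=
  isNonDilatingOn_trivialMonoidOn Ex36.FG (Multiplicative Ex36.G)

end Literature.AlgebraicGeometry.Frobenioids
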